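import Mathlib
import Literature.MathematicalPhysics.QuantumFieldTheory.Balaban1983to89.B16Sect1Statements

/-!
# `Balaban1983to89.B16Ineq124Absorption` — T. Bałaban, *Large field renormalization. II. Localization, exponentiation,
and bounds for the 𝐑 operation*, Commun. Math. Phys. **122**, 355–392 (1989), doi:10.1007/bf01238433
[Balaban1989LargeFieldII] (cell paper B16; PDF held `paper:balaban1989-cmp122-large-field-ii`, journal page = PDF page
+ 354): the ABSORPTION behind the bound on the second term of (1.24), p. 362 — the multi-scale volume factor and
`R_k^{β₀}` are swallowed by `exp(−δMR_{h+1})`, leaving `O(1)M^dR_k^{d+1}exp(−R_k)` — PROVED at mechanism level, so that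
the sibling's display `B16Sect1Statements.Ineq124snd` (typed there with the remark *"the absorption … uses N ≦ R_k and δM
large — and is not re-derived here"*) is DERIVED from explicit inputs (mega-formalization `lit-balaban`, reader/typer
block r13, generation 8; SKELETON rows B16.Txt@362, B16.Eq1.24).

Statement-level skeleton of published theorems with citation tags; proofs where landed; nothing here is a claim about the Yang–Mills mass gap.

THE PRINTED SENTENCE (p. 362 [8], render `1989-cmp122-large-field-II-p008-x4.png` re-read by this seat): *"This
equality, the bounds for the configuration U₀, and the bounds (1.23) imply that the last three terms on the right-hand
side of the equality (1.24) are small, after dividing by g_k². For example, the second term can be bounded by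
O(1)B₃B₅M⁵ε_kB₃exp(−δMR_{h+1})11d²(1 + β₀)²R_k^{β₀}ε_k·(|Ω″_k ∩ Ω^c_k| + L^{d−2}|Ω″_{k−1}∖Ω″_k| + ⋯ +
L^{(N−1)(d−2)}|Ω″_{h+1}∖Ω″_{h+2}|) ≦ g_k²O(1)A₀²B₃²B₅M^{d+5}R_k^{d+1}p₀²(g_k)exp(−R_k),"*.

WHAT IS HERE (and what is an input).  The text displays no derivation of the `≦`.  The mechanism proved below is the
one the cell transcript records at this place (`run/shared/lean/pub/pub-balaban/b2b-balaban-b02/B16-transcript.md`,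
p. 362 [chk]): (i) each of the `N` layer volumes, measured in its own scale, is at most `C_v(MR_k)^d` — an explicit
HYPOTHESIS `hv` here (the text does not display this count; it is the same kind of count as `|𝐁₀| ≦ (100MR_k)^dN²`
used on p. 361 for the same region), so the volume factor `W` = `B16Sect1Statements.vol124` is at most
`N·L^{(N−1)(d−2)}·C_v(MR_k)^d` (`vol124_le`); (ii) with *"We have assumed here that N ≦ R_k"* (p. 361,
`B16Sect1Kernels.NWindowUpper`), `R_k ≦ R_{h+1}` and the largeness `δM ≧ 1 + β₀ + (d − 2)log L` of `δM` (both
explicit hypotheses), `exp(−δMR_{h+1})·R_k^{β₀}·L^{(N−1)(d−2)} ≦ exp(−R_k)` (`absorb_exp`); (iii) hence `Ineq124snd`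
holds with the explicit constant `C' = C·C_v·11d²(1 + β₀)²` and `ε_k = g_kA₀p₀(g_k)` ([III] (2.4)) — `ineq124snd_of_layers`.
Nothing else is asserted; the smallness of the resulting number for `g_k` small is `B16Sect1SmallFactors.ineq124snd_const_small`.
-/

namespace Literature.MathematicalPhysics.QuantumFieldTheory.Balaban1983to89.B16Ineq124Absorption

open Real Finset
open Literature.MathematicalPhysics.QuantumFieldTheory.Balaban1983to89

/-- **The multi-scale volume factor of p. 362 under the per-layer reading**: if each of the `N` layer volumes
`v i` (`v 0 = |Ω″_k ∩ Ω^c_k|`, `v i = |Ω″_{k−i}∖Ω″_{k−i+1}|`) is nonnegative and at most `K`, then for `L ≧ 1` the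
factor `(|Ω″_k ∩ Ω^c_k| + L^{d−2}|Ω″_{k−1}∖Ω″_k| + ⋯ + L^{(N−1)(d−2)}|Ω″_{h+1}∖Ω″_{h+2}|)` = `vol124 L d N v` is at
most `N·L^{(N−1)(d−2)}·K`. PROVED (the per-layer bound is the input, see the module docstring). [cite: Balaban1989LargeFieldII, (1.24)–(1.25) p.362] -/
theorem vol124_le {L K : ℝ} {d N : ℕ} {v : ℕ → ℝ} (hL : 1 ≤ L) (hv : ∀ i, i < N → 0 ≤ v i ∧ v i ≤ K) :
    B16Sect1Statements.vol124 L d N v ≤ N * (L ^ ((N - 1) * (d - 2)) * K) := by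
  unfold B16Sect1Statements.vol124
  have hK : ∀ i ∈ range N, L ^ (i * (d - 2)) * v i ≤ L ^ ((N - 1) * (d - 2)) * K := by
    intro i hi
    have hi' : i < N := mem_range.mp hi
    obtain ⟨h0, h1⟩ := hv i hi'
    have hpow : L ^ (i * (d - 2)) ≤ L ^ ((N - 1) * (d - 2)) :=
      pow_le_pow_right₀ hL (Nat.mul_le_mul_right _ (by omega))
    exact mul_le_mul hpow h1 h0 (by positivity)
  calc ∑ i ∈ range N, L ^ (i * (d - 2)) * v i ≤ ∑ i ∈ range N, L ^ ((N - 1) * (d - 2)) * K := sum_le_sum hK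
    _ = N * (L ^ ((N - 1) * (d - 2)) * K) := by rw [sum_const, card_range, nsmul_eq_mul]

/-- **The exponential absorption of p. 362**: under *"N ≦ R_k"* (p. 361, `B16Sect1Kernels.NWindowUpper`), `0 ≦ R_k ≦
R_{h+1}` and the largeness `1 + β₀ + (d − 2)log L ≦ δM` of `δM` (`d ≧ 2`, `L ≧ 1`, `β₀ ≧ 0`), the factors
`exp(−δMR_{h+1})`, `R_k^{β₀}` and `L^{(N−1)(d−2)}` of the p. 362 bound combine to at most `exp(−R_k)`:
`R_k^{β₀} ≦ e^{β₀R_k}`, `L^{(N−1)(d−2)} ≦ e^{(d−2)(log L)R_k}`, `e^{−δMR_{h+1}} ≦ e^{−δMR_k}`. PROVED. [cite: Balaban1989LargeFieldII, (1.24)–(1.25) p.362] -/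
theorem absorb_exp {δ M Rh1 Rk β₀ L : ℝ} {d N : ℕ} (hd : 2 ≤ d) (hL : 1 ≤ L) (hβ₀ : 0 ≤ β₀) (hRk : 0 ≤ Rk)
    (hRh : Rk ≤ Rh1) (hN : B16Sect1Kernels.NWindowUpper N Rk)
    (hδM : 1 + β₀ + ((d : ℝ) - 2) * Real.log L ≤ δ * M) :
    Real.exp (-(δ * M * Rh1)) * Rk ^ β₀ * L ^ ((N - 1) * (d - 2)) ≤ Real.exp (-Rk) := by
  have hN' : (N : ℝ) ≤ Rk := hN
  have hL0 : 0 < L := by linarith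
  have hlogL : 0 ≤ Real.log L := Real.log_nonneg hL
  have hd2 : (((d - 2 : ℕ) : ℝ)) = (d : ℝ) - 2 := by rw [Nat.cast_sub hd]; norm_num
  -- R_k^{β₀} ≤ exp(β₀ R_k)
  have h1 : Rk ^ β₀ ≤ Real.exp (β₀ * Rk) := by
    have hle : Rk ≤ Real.exp Rk := by linarith [Real.add_one_le_exp Rk]
    calc Rk ^ β₀ ≤ (Real.exp Rk) ^ β₀ := Real.rpow_le_rpow hRk hle hβ₀
      _ = Real.exp (β₀ * Rk) := by rw [← Real.exp_mul, mul_comm]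
  -- L^{(N-1)(d-2)} ≤ exp((d-2) log L · R_k)
  have h2 : L ^ ((N - 1) * (d - 2)) ≤ Real.exp (((d : ℝ) - 2) * Real.log L * Rk) := by
    have hnat : (N - 1) * (d - 2) ≤ N * (d - 2) := Nat.mul_le_mul_right _ (Nat.sub_le N 1)
    have hcast : (((N - 1) * (d - 2) : ℕ) : ℝ) ≤ Rk * ((d : ℝ) - 2) := by
      calc (((N - 1) * (d - 2) : ℕ) : ℝ) ≤ ((N * (d - 2) : ℕ) : ℝ) := by exact_mod_cast hnat
        _ = (N : ℝ) * ((d : ℝ) - 2) := by rw [Nat.cast_mul, hd2]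
        _ ≤ Rk * ((d : ℝ) - 2) := by
            have : (0 : ℝ) ≤ (d : ℝ) - 2 := by rw [← hd2]; exact Nat.cast_nonneg _
            exact mul_le_mul_of_nonneg_right hN' this
    have e : L ^ ((N - 1) * (d - 2)) = Real.exp (Real.log L * (((N - 1) * (d - 2) : ℕ) : ℝ)) := by
      rw [← Real.rpow_natCast, Real.rpow_def_of_pos hL0]
    rw [e, Real.exp_le_exp]
    calc Real.log L * (((N - 1) * (d - 2) : ℕ) : ℝ) ≤ Real.log L * (Rk * ((d : ℝ) - 2)) :=
          mul_le_mul_of_nonneg_left hcast hlogL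
      _ = ((d : ℝ) - 2) * Real.log L * Rk := by ring
  -- exp(-δ M R_{h+1}) ≤ exp(-δ M R_k)
  have hδM0 : 0 ≤ δ * M := by
    have : 0 ≤ ((d : ℝ) - 2) * Real.log L := by
      have : (0 : ℝ) ≤ (d : ℝ) - 2 := by rw [← hd2]; exact Nat.cast_nonneg _
      positivity
    linarith
  have h3 : Real.exp (-(δ * M * Rh1)) ≤ Real.exp (-(δ * M * Rk)) := by
    apply Real.exp_le_exp.mpr
    have : δ * M * Rk ≤ δ * M * Rh1 := mul_le_mul_of_nonneg_left hRh hδM0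
    linarith
  calc Real.exp (-(δ * M * Rh1)) * Rk ^ β₀ * L ^ ((N - 1) * (d - 2))
      ≤ Real.exp (-(δ * M * Rk)) * Real.exp (β₀ * Rk) * Real.exp (((d : ℝ) - 2) * Real.log L * Rk) :=
        mul_le_mul (mul_le_mul h3 h1 (Real.rpow_nonneg hRk _) (Real.exp_pos _).le) h2 (by positivity)
          (by positivity)
    _ = Real.exp (-(δ * M * Rk) + β₀ * Rk + ((d : ℝ) - 2) * Real.log L * Rk) := by
        rw [Real.exp_add, Real.exp_add]
    _ ≤ Real.exp (-Rk) := by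
        apply Real.exp_le_exp.mpr
        have : (1 + β₀ + ((d : ℝ) - 2) * Real.log L) * Rk ≤ δ * M * Rk := mul_le_mul_of_nonneg_right hδM hRk
        nlinarith

/-- **The bound on the second term of (1.24), DERIVED** (p. 362 [8], render p008): under the per-layer volume reading
(`hv`: each layer volume is `≦ C_v(MR_k)^d`, `W = vol124 L d N v`), *"N ≦ R_k"* (`B16Sect1Kernels.NWindowUpper`), `0 ≦
R_k ≦ R_{h+1}`, the largeness `1 + β₀ + (d − 2)log L ≦ δM`, `ε_k = g_kA₀p₀(g_k)` ([III] (2.4)) and nonnegative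
constants, the sibling's display `B16Sect1Statements.Ineq124snd` HOLDS with the explicit `O(1)`:
`C' = C·C_v·11d²(1 + β₀)²`, i.e. *"O(1)B₃B₅M⁵ε_kB₃exp(−δMR_{h+1})11d²(1 + β₀)²R_k^{β₀}ε_k·(…volumes…) ≦
g_k²O(1)A₀²B₃²B₅M^{d+5}R_k^{d+1}p₀²(g_k)exp(−R_k)"*. PROVED from `vol124_le` and `absorb_exp`. [cite: Balaban1989LargeFieldII, (1.24)–(1.25) p.362] -/
theorem ineq124snd_of_layers {C B₃ B₅ M εk δ Rh1 β₀ Rk W gk A₀ p₀g L Cv : ℝ} {d N : ℕ} {v : ℕ → ℝ}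
    (hC : 0 ≤ C) (hB₅ : 0 ≤ B₅) (hM : 0 ≤ M) (hCv : 0 ≤ Cv) (hL : 1 ≤ L) (hd : 2 ≤ d) (hβ₀ : 0 ≤ β₀)
    (hRk : 0 ≤ Rk) (hRh : Rk ≤ Rh1) (hN : B16Sect1Kernels.NWindowUpper N Rk)
    (hδM : 1 + β₀ + ((d : ℝ) - 2) * Real.log L ≤ δ * M) (hε : εk = gk * A₀ * p₀g)
    (hv : ∀ i, i < N → 0 ≤ v i ∧ v i ≤ Cv * (M * Rk) ^ d) (hW : W = B16Sect1Statements.vol124 L d N v) :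
    B16Sect1Statements.Ineq124snd C B₃ B₅ M εk δ Rh1 d β₀ Rk W gk
      (C * Cv * 11 * (d : ℝ) ^ 2 * (1 + β₀) ^ 2) A₀ p₀g := by
  unfold B16Sect1Statements.Ineq124snd B16Sect1Statements.rhs123
  have hN' : (N : ℝ) ≤ Rk := hN
  have hN0 : (0 : ℝ) ≤ N := Nat.cast_nonneg N
  -- (i) the volume factor
  have hW1 : W ≤ N * (L ^ ((N - 1) * (d - 2)) * (Cv * (M * Rk) ^ d)) := by
    rw [hW]; exact vol124_le hL hv
  have hW2 : W ≤ Rk * (L ^ ((N - 1) * (d - 2)) * (Cv * (M * Rk) ^ d)) :=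
    hW1.trans (mul_le_mul_of_nonneg_right hN' (by positivity))
  have hW0 : 0 ≤ W := by
    rw [hW]; unfold B16Sect1Statements.vol124
    exact sum_nonneg fun i hi => mul_nonneg (by positivity) (hv i (mem_range.mp hi)).1
  -- (ii) the exponential absorption
  have hA := absorb_exp hd hL hβ₀ hRk hRh hN hδM
  -- the common nonnegative prefactor
  have hP : 0 ≤ C * B₃ * B₅ * M ^ 5 * εk * (B₃ * (11 * (d : ℝ) ^ 2 * (1 + β₀) ^ 2 * εk)) := by
    have : C * B₃ * B₅ * M ^ 5 * εk * (B₃ * (11 * (d : ℝ) ^ 2 * (1 + β₀) ^ 2 * εk)) =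
        C * B₅ * M ^ 5 * (11 * (d : ℝ) ^ 2 * (1 + β₀) ^ 2) * (B₃ * εk) ^ 2 := by ring
    rw [this]; positivity
  calc C * B₃ * B₅ * M ^ 5 * εk *
        (B₃ * Real.exp (-(δ * M * Rh1)) * (11 * (d : ℝ) ^ 2 * (1 + β₀) ^ 2 * Rk ^ β₀ * εk)) * W
      = C * B₃ * B₅ * M ^ 5 * εk * (B₃ * (11 * (d : ℝ) ^ 2 * (1 + β₀) ^ 2 * εk)) *
          (Real.exp (-(δ * M * Rh1)) * Rk ^ β₀) * W := by ring
    _ ≤ C * B₃ * B₅ * M ^ 5 * εk * (B₃ * (11 * (d : ℝ) ^ 2 * (1 + β₀) ^ 2 * εk)) *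
          (Real.exp (-(δ * M * Rh1)) * Rk ^ β₀) * (Rk * (L ^ ((N - 1) * (d - 2)) * (Cv * (M * Rk) ^ d))) :=
        mul_le_mul_of_nonneg_left hW2 (by positivity)
    _ = C * B₃ * B₅ * M ^ 5 * εk * (B₃ * (11 * (d : ℝ) ^ 2 * (1 + β₀) ^ 2 * εk)) * (Rk * (Cv * (M * Rk) ^ d)) *
          (Real.exp (-(δ * M * Rh1)) * Rk ^ β₀ * L ^ ((N - 1) * (d - 2))) := by ring
    _ ≤ C * B₃ * B₅ * M ^ 5 * εk * (B₃ * (11 * (d : ℝ) ^ 2 * (1 + β₀) ^ 2 * εk)) * (Rk * (Cv * (M * Rk) ^ d)) *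
          Real.exp (-Rk) := mul_le_mul_of_nonneg_left hA (by positivity)
    _ = gk ^ 2 * (C * Cv * 11 * (d : ℝ) ^ 2 * (1 + β₀) ^ 2) * A₀ ^ 2 * B₃ ^ 2 * B₅ * M ^ (d + 5) *
          Rk ^ (d + 1) * p₀g ^ 2 * Real.exp (-Rk) := by
        rw [hε]; ring

/-! ## §4. v1.1 (r13 gen 9): the per-layer volumes FROM CONDITION (i) [IV] — lattice-point counting across scales

THE INPUT `hv` OF `ineq124snd_of_layers` DISCHARGED FROM PRINT.  Where the layer volumes of the p. 362 display come
from (renders `1989-cmp122-large-field-I-p003-x2.png`, `…-p005-x2.png` of [IV] = [Balaban1989LargeFieldI] and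
`1989-cmp122-large-field-II-p008-x2.png` re-read as images by this seat; [IV] p. 180 from the OCR text layer):
* [IV] p. 177: the 𝐑-operation works on the class of components of the large field region such that each satisfies
  *"(i) it is contained in a cube of the size 100MR_k,"* (scale-`k` units) and (ii); *"Let us denote the union of the
  above class of components by Z"*, and by the factorization (1.1) [IV] `𝐓_k(Z) = 𝐓_k(Z_k ∩ Zᶜ)∏_i 𝐓_k(X_i)` over the
  disjoint components `X_i` the constructions are carried out component by component (B16 p. 356: *"identifying Λ
  with one of its components"*; B16 p. 381: *"components of a large field region Z_j, which satisfies the conditions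
  (i), (ii)"*) — below, `Z` is ONE such component;
* [IV] (1.10)–(1.12) p. 179: *"Z″_j = (Ω_j^{~5})ᶜ ∩ Z for j = k − N₀, …, h + 1"*, *"Ω″_j = (Z″ᶜ_j ∩ Z) ∪ (Ω_j ∩ Zᶜ) for
  j = k, k − 1, …, h + 1"*, and p. 180 *"Here, and in the subsequent formulas, the symbols Γ_j mean the intersections of
  these sets with the region Z"*; hence inside `Z` one has `Ω″_k ∩ Ω_kᶜ ∩ Z = (Z∖Z″_k) ∩ Ω_kᶜ ⊂ Z` and
  `(Ω″_j∖Ω″_{j+1}) ∩ Z = Z″_{j+1}∖Z″_j ⊂ Z` — every one of the `N` layer regions of the p. 362 display, intersected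
  with `Z`, is a subset of ONE cube of side `100MR_k`.  READING (declared): the display's volumes are those of the
  layers inside `Z`, the support region of the expansion (B16 p. 361 *"It is supported in the domain Z ∩ Ω″~²_{h+1} and
  on this domain we have (1.22)"*); outside `Z` the sets `Ω″_j∖Ω″_{j+1} ⊃ (Ω_j∖Ω_{j+1}) ∩ Zᶜ` are whole-lattice
  layers, for which the printed right-hand side `…M^{d+5}R_k^{d+1}…` could not hold;
* the scale-`j` lattice has spacing `L^jη = L^{−(k−j)}` in scale-`k` units ([IV] p. 179 *"the domains Ω_j^{~n} are unions
  of L^{−(k−j)}MR_j-cubes of the lattice T_η"*), and a scale-`j` volume counts scale-`j` lattice sites (B16 p. 380 *"Here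
  the volume is for the L^{−j}-scale"* for the same kind of count): a site of the scale-`(k−i)` lattice inside the cube
  has integer coordinates `x_c` with `0 ≦ x_c < 100MR_k·L^{i}` — the HYPOTHESIS `hΛ` below, which a fortiori covers the
  coarser reading (volumes in scale-`k` sites, `x_c < 100MR_k ≦ 100MR_k·L^i`).
WHAT IS PROVED: `#{x ∈ Λ} ≦ (T + 1)^d` when all coordinates of the points of `Λ ⊂ ℤ^d` lie in `[0, T)`
(`card_le_pow_of_coords_lt`, `card_le_pow_of_coords_lt_real`); hence layer `i` has at most `101^d(MR_k)^d(L^i)^d`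
sites for `MR_k ≧ 1` (`layerCard_le`); the volume factor is then at most `N·101^d(MR_k)^d·L^{(N−1)(d−2)}·L^{(N−1)d}`
(`vol124_le`) and the extra power of `L` is absorbed exactly as in `absorb_exp`, now under the largeness
`1 + β₀ + (2d − 2)log L ≦ δM` (`absorb_exp_pow`; p. 360: the exponential factor *"suppresses all powers of log g_k⁻²,
and all powers of M"*, here of `L^N`, `N ≦ R_k`), giving `Ineq124snd` AS TYPED with `O(1) = C·101^d·11d²(1 + β₀)²`
from condition (i) alone (`ineq124snd_of_cube`).  Print displays no count at this place; nothing else is asserted,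
in particular not the sharper geometric fact that the layers `Z″_{j+1}∖Z″_j` are thin shells ([IV] p. 179). -/

/-- Lattice-point count in a box: a finite set of points of `ℤ^d` all of whose coordinates lie in `[0, n)` has at
most `n^d` elements (it sits inside `Fintype.piFinset (fun _ => Finset.Ico 0 n)`). The formal content of *"contained
in a cube of the size 100MR_k"* ⇒ volume `≦ (100MR_k)^d` per scale. [cite: Balaban1989LargeFieldI, condition (i) p.177] -/
theorem card_le_pow_of_coords_lt {d : ℕ} (Ω : Finset (Fin d → ℤ)) (n : ℕ)
    (hΩ : ∀ x ∈ Ω, ∀ c, 0 ≤ x c ∧ x c < n) : Ω.card ≤ n ^ d := by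
  have hsub : Ω ⊆ Fintype.piFinset (fun _ : Fin d => Finset.Ico (0 : ℤ) n) := by
    intro x hx
    rw [Fintype.mem_piFinset]
    intro c
    rw [Finset.mem_Ico]
    exact hΩ x hx c
  calc Ω.card ≤ (Fintype.piFinset (fun _ : Fin d => Finset.Ico (0 : ℤ) n)).card := Finset.card_le_card hsub
    _ = n ^ d := by
        rw [Fintype.card_piFinset, Finset.prod_const, Finset.card_univ, Fintype.card_fin]
        congr 1
        rw [Int.card_Ico]; simp

/-- Real-threshold form of `card_le_pow_of_coords_lt`: if every coordinate of every point of `Λ ⊂ ℤ^d` lies in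
`[0, T)` for a real `T ≧ 0`, then `|Λ| ≦ (T + 1)^d` (via `n = ⌈T⌉ ≦ T + 1`). [cite: Balaban1989LargeFieldI, condition (i) p.177] -/
theorem card_le_pow_of_coords_lt_real {d : ℕ} (Λ : Finset (Fin d → ℤ)) {T : ℝ} (hT : 0 ≤ T)
    (hΛ : ∀ x ∈ Λ, ∀ c, (0 : ℝ) ≤ x c ∧ (x c : ℝ) < T) : (Λ.card : ℝ) ≤ (T + 1) ^ d := by
  set n : ℕ := ⌈T⌉₊ with hn
  have hcoord : ∀ x ∈ Λ, ∀ c, 0 ≤ x c ∧ x c < n := by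
    intro x hx c
    obtain ⟨h0, h1⟩ := hΛ x hx c
    refine ⟨by exact_mod_cast h0, ?_⟩
    have h3 : (x c : ℝ) < (n : ℝ) := lt_of_lt_of_le h1 (Nat.le_ceil _)
    have h4 : ((x c : ℤ) : ℝ) < ((n : ℤ) : ℝ) := by simpa using h3
    exact_mod_cast h4
  have hcard := card_le_pow_of_coords_lt Λ n hcoord
  have hn1 : (n : ℝ) ≤ T + 1 := (Nat.ceil_lt_add_one hT).le
  calc (Λ.card : ℝ) ≤ ((n ^ d : ℕ) : ℝ) := by exact_mod_cast hcard
    _ = (n : ℝ) ^ d := by push_cast; ring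
    _ ≤ (T + 1) ^ d := pow_le_pow_left₀ (Nat.cast_nonneg n) hn1 d

/-- **Layer volume under condition (i) [IV].** The `i`-th layer region of the p. 362 display (`i = k − j`; `Ω″_k ∩ Ω_kᶜ`
for `i = 0`, `Ω″_{k−i}∖Ω″_{k−i+1}` for `i ≧ 1`, inside `Z`), given as a finite set `Λ` of sites of the scale-`(k−i)`
lattice (spacing `L^{−i}` in scale-`k` units) lying in the cube of condition (i) — integer coordinates `0 ≦ x_c <
100MR_k·L^i` — has at most `101^d(MR_k)^d(L^i)^d` sites, for `MR_k ≧ 1`, `L ≧ 1`. [cite: Balaban1989LargeFieldI, condition (i) p.177, (1.10)–(1.12) p.179; Balaban1989LargeFieldII, (1.24)–(1.25) p.362] -/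
theorem layerCard_le {d : ℕ} {M Rk L : ℝ} (hL : 1 ≤ L) (hMR : 1 ≤ M * Rk) (i : ℕ) (Λ : Finset (Fin d → ℤ))
    (hΛ : ∀ x ∈ Λ, ∀ c, (0 : ℝ) ≤ x c ∧ (x c : ℝ) < 100 * M * Rk * L ^ i) :
    (Λ.card : ℝ) ≤ 101 ^ d * (M * Rk) ^ d * (L ^ i) ^ d := by
  have hLi : 1 ≤ L ^ i := one_le_pow₀ hL
  have hT : (0 : ℝ) ≤ 100 * M * Rk * L ^ i := by nlinarith
  have h1 := card_le_pow_of_coords_lt_real Λ hT hΛ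
  have h2 : 100 * M * Rk * L ^ i + 1 ≤ 101 * (M * Rk) * L ^ i := by nlinarith
  have h0 : 0 ≤ 100 * M * Rk * L ^ i + 1 := by positivity
  calc (Λ.card : ℝ) ≤ (100 * M * Rk * L ^ i + 1) ^ d := h1
    _ ≤ (101 * (M * Rk) * L ^ i) ^ d := pow_le_pow_left₀ h0 h2 d
    _ = 101 ^ d * (M * Rk) ^ d * (L ^ i) ^ d := by rw [mul_pow, mul_pow]

/-- **The exponential absorption of p. 362 with a general power of `L`**: under *"N ≦ R_k"* (p. 361,
`B16Sect1Kernels.NWindowUpper`), `0 ≦ R_k ≦ R_{h+1}` and the largeness `1 + β₀ + m·log L ≦ δM` (`L ≧ 1`, `β₀ ≧ 0`),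
`exp(−δMR_{h+1})·R_k^{β₀}·L^{(N−1)m} ≦ exp(−R_k)` (p. 360: the exponential factor *"suppresses all powers of
log g_k⁻², and all powers of M"* — here: of `L^N`, `N ≦ R_k`). PROVED; `absorb_exp` is the case `m = d − 2`. [cite: Balaban1989LargeFieldII, (1.24)–(1.25) p.362] -/
theorem absorb_exp_pow {δ M Rh1 Rk β₀ L : ℝ} {N m : ℕ} (hL : 1 ≤ L) (hβ₀ : 0 ≤ β₀) (hRk : 0 ≤ Rk)
    (hRh : Rk ≤ Rh1) (hN : B16Sect1Kernels.NWindowUpper N Rk)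
    (hδM : 1 + β₀ + (m : ℝ) * Real.log L ≤ δ * M) :
    Real.exp (-(δ * M * Rh1)) * Rk ^ β₀ * L ^ ((N - 1) * m) ≤ Real.exp (-Rk) := by
  have hN' : (N : ℝ) ≤ Rk := hN
  have hL0 : 0 < L := by linarith
  have hlogL : 0 ≤ Real.log L := Real.log_nonneg hL
  have hm0 : (0 : ℝ) ≤ m := Nat.cast_nonneg m
  -- R_k^{β₀} ≤ exp(β₀ R_k)
  have h1 : Rk ^ β₀ ≤ Real.exp (β₀ * Rk) := by
    have hle : Rk ≤ Real.exp Rk := by linarith [Real.add_one_le_exp Rk]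
    calc Rk ^ β₀ ≤ (Real.exp Rk) ^ β₀ := Real.rpow_le_rpow hRk hle hβ₀
      _ = Real.exp (β₀ * Rk) := by rw [← Real.exp_mul, mul_comm]
  -- L^{(N-1)m} ≤ exp(m log L · R_k)
  have h2 : L ^ ((N - 1) * m) ≤ Real.exp ((m : ℝ) * Real.log L * Rk) := by
    have hnat : (N - 1) * m ≤ N * m := Nat.mul_le_mul_right _ (Nat.sub_le N 1)
    have hcast : (((N - 1) * m : ℕ) : ℝ) ≤ Rk * (m : ℝ) := by
      calc (((N - 1) * m : ℕ) : ℝ) ≤ ((N * m : ℕ) : ℝ) := by exact_mod_cast hnat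
        _ = (N : ℝ) * (m : ℝ) := by rw [Nat.cast_mul]
        _ ≤ Rk * (m : ℝ) := mul_le_mul_of_nonneg_right hN' hm0
    have e : L ^ ((N - 1) * m) = Real.exp (Real.log L * (((N - 1) * m : ℕ) : ℝ)) := by
      rw [← Real.rpow_natCast, Real.rpow_def_of_pos hL0]
    rw [e, Real.exp_le_exp]
    calc Real.log L * (((N - 1) * m : ℕ) : ℝ) ≤ Real.log L * (Rk * (m : ℝ)) :=
          mul_le_mul_of_nonneg_left hcast hlogL
      _ = (m : ℝ) * Real.log L * Rk := by ring
  -- exp(-δ M R_{h+1}) ≤ exp(-δ M R_k)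
  have hδM0 : 0 ≤ δ * M := by
    have : 0 ≤ (m : ℝ) * Real.log L := by positivity
    linarith
  have h3 : Real.exp (-(δ * M * Rh1)) ≤ Real.exp (-(δ * M * Rk)) := by
    apply Real.exp_le_exp.mpr
    have : δ * M * Rk ≤ δ * M * Rh1 := mul_le_mul_of_nonneg_left hRh hδM0
    linarith
  calc Real.exp (-(δ * M * Rh1)) * Rk ^ β₀ * L ^ ((N - 1) * m)
      ≤ Real.exp (-(δ * M * Rk)) * Real.exp (β₀ * Rk) * Real.exp ((m : ℝ) * Real.log L * Rk) :=
        mul_le_mul (mul_le_mul h3 h1 (Real.rpow_nonneg hRk _) (Real.exp_pos _).le) h2 (by positivity)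
          (by positivity)
    _ = Real.exp (-(δ * M * Rk) + β₀ * Rk + (m : ℝ) * Real.log L * Rk) := by
        rw [Real.exp_add, Real.exp_add]
    _ ≤ Real.exp (-Rk) := by
        apply Real.exp_le_exp.mpr
        have : (1 + β₀ + (m : ℝ) * Real.log L) * Rk ≤ δ * M * Rk := mul_le_mul_of_nonneg_right hδM hRk
        nlinarith

/-- **The bound on the second term of (1.24) FROM CONDITION (i) [IV]** (p. 362 [8], render p008): with the `N` layer
regions of the display given as finite sets `Λ i` of sites of the scale-`(k−i)` lattice inside the cube of condition (i)
(`hΛ`: integer coordinates `0 ≦ x_c < 100MR_k·L^i` — [IV] p. 177 (i) + (1.10)–(1.12) p. 179, see the §4 header for the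
reading), `W = vol124 L d N (i ↦ |Λ i|)`, *"N ≦ R_k"* (`B16Sect1Kernels.NWindowUpper`), `0 ≦ R_k ≦ R_{h+1}`, `MR_k ≧
1`, the largeness `1 + β₀ + (2d − 2)log L ≦ δM`, `ε_k = g_kA₀p₀(g_k)` ([III] (2.4)) and nonnegative constants, the
sibling's display `B16Sect1Statements.Ineq124snd` HOLDS with the explicit `O(1)`: `C' = C·101^d·11d²(1 + β₀)²` — the
per-layer volume input of `ineq124snd_of_layers` is no longer a hypothesis. PROVED from `layerCard_le`, `vol124_le`
and `absorb_exp_pow`. [cite: Balaban1989LargeFieldII, (1.24)–(1.25) p.362; Balaban1989LargeFieldI, condition (i) p.177, (1.10)–(1.12) p.179] -/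
theorem ineq124snd_of_cube {C B₃ B₅ M εk δ Rh1 β₀ Rk W gk A₀ p₀g L : ℝ} {d N : ℕ}
    {Λ : ℕ → Finset (Fin d → ℤ)}
    (hC : 0 ≤ C) (hB₅ : 0 ≤ B₅) (hM : 0 ≤ M) (hL : 1 ≤ L) (hd : 2 ≤ d) (hβ₀ : 0 ≤ β₀)
    (hRk : 0 ≤ Rk) (hRh : Rk ≤ Rh1) (hMR : 1 ≤ M * Rk) (hN : B16Sect1Kernels.NWindowUpper N Rk)
    (hδM : 1 + β₀ + (2 * (d : ℝ) - 2) * Real.log L ≤ δ * M) (hε : εk = gk * A₀ * p₀g)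
    (hΛ : ∀ i, i < N → ∀ x ∈ Λ i, ∀ c, (0 : ℝ) ≤ x c ∧ (x c : ℝ) < 100 * M * Rk * L ^ i)
    (hW : W = B16Sect1Statements.vol124 L d N (fun i => ((Λ i).card : ℝ))) :
    B16Sect1Statements.Ineq124snd C B₃ B₅ M εk δ Rh1 d β₀ Rk W gk
      (C * 101 ^ d * 11 * (d : ℝ) ^ 2 * (1 + β₀) ^ 2) A₀ p₀g := by
  unfold B16Sect1Statements.Ineq124snd B16Sect1Statements.rhs123
  have hN' : (N : ℝ) ≤ Rk := hN
  have hL0 : 0 ≤ L := by linarith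
  -- (i) the per-layer volumes from condition (i), uniformised over i < N
  set K : ℝ := 101 ^ d * (M * Rk) ^ d * (L ^ (N - 1)) ^ d with hK
  have hv : ∀ i, i < N → 0 ≤ (((Λ i).card : ℝ)) ∧ ((Λ i).card : ℝ) ≤ K := by
    intro i hi
    refine ⟨Nat.cast_nonneg _, ?_⟩
    have h1 := layerCard_le hL hMR i (Λ i) (hΛ i hi)
    have h2 : (L ^ i) ^ d ≤ (L ^ (N - 1)) ^ d :=
      pow_le_pow_left₀ (by positivity) (pow_le_pow_right₀ hL (by omega)) d
    calc ((Λ i).card : ℝ) ≤ 101 ^ d * (M * Rk) ^ d * (L ^ i) ^ d := h1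
      _ ≤ 101 ^ d * (M * Rk) ^ d * (L ^ (N - 1)) ^ d := mul_le_mul_of_nonneg_left h2 (by positivity)
  have hW1 : W ≤ N * (L ^ ((N - 1) * (d - 2)) * K) := by rw [hW]; exact vol124_le hL hv
  -- the two powers of L combine to L^{(N-1)(2d-2)}
  have hpow : L ^ ((N - 1) * (d - 2)) * (L ^ (N - 1)) ^ d = L ^ ((N - 1) * (d - 2 + d)) := by
    rw [← pow_mul, ← pow_add]; congr 1; rw [Nat.mul_add]
  have hW2 : W ≤ Rk * (101 ^ d * (M * Rk) ^ d) * L ^ ((N - 1) * (d - 2 + d)) := by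
    calc W ≤ N * (L ^ ((N - 1) * (d - 2)) * K) := hW1
      _ = N * (101 ^ d * (M * Rk) ^ d) * (L ^ ((N - 1) * (d - 2)) * (L ^ (N - 1)) ^ d) := by rw [hK]; ring
      _ = N * (101 ^ d * (M * Rk) ^ d) * L ^ ((N - 1) * (d - 2 + d)) := by rw [hpow]
      _ ≤ Rk * (101 ^ d * (M * Rk) ^ d) * L ^ ((N - 1) * (d - 2 + d)) :=
          mul_le_mul_of_nonneg_right (mul_le_mul_of_nonneg_right hN' (by positivity)) (by positivity)
  -- (ii) the exponential absorption with m = 2d - 2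
  have hm : (((d - 2 + d : ℕ)) : ℝ) = 2 * (d : ℝ) - 2 := by
    rw [Nat.cast_add, Nat.cast_sub hd]; push_cast; ring
  have hδM' : 1 + β₀ + (((d - 2 + d : ℕ)) : ℝ) * Real.log L ≤ δ * M := by rw [hm]; exact hδM
  have hA := absorb_exp_pow (m := d - 2 + d) hL hβ₀ hRk hRh hN hδM'
  -- the common nonnegative prefactor
  have hP : 0 ≤ C * B₃ * B₅ * M ^ 5 * εk * (B₃ * (11 * (d : ℝ) ^ 2 * (1 + β₀) ^ 2 * εk)) := by
    have : C * B₃ * B₅ * M ^ 5 * εk * (B₃ * (11 * (d : ℝ) ^ 2 * (1 + β₀) ^ 2 * εk)) =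
        C * B₅ * M ^ 5 * (11 * (d : ℝ) ^ 2 * (1 + β₀) ^ 2) * (B₃ * εk) ^ 2 := by ring
    rw [this]; positivity
  calc C * B₃ * B₅ * M ^ 5 * εk *
        (B₃ * Real.exp (-(δ * M * Rh1)) * (11 * (d : ℝ) ^ 2 * (1 + β₀) ^ 2 * Rk ^ β₀ * εk)) * W
      = C * B₃ * B₅ * M ^ 5 * εk * (B₃ * (11 * (d : ℝ) ^ 2 * (1 + β₀) ^ 2 * εk)) *
          (Real.exp (-(δ * M * Rh1)) * Rk ^ β₀) * W := by ring
    _ ≤ C * B₃ * B₅ * M ^ 5 * εk * (B₃ * (11 * (d : ℝ) ^ 2 * (1 + β₀) ^ 2 * εk)) *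
          (Real.exp (-(δ * M * Rh1)) * Rk ^ β₀) * (Rk * (101 ^ d * (M * Rk) ^ d) * L ^ ((N - 1) * (d - 2 + d))) :=
        mul_le_mul_of_nonneg_left hW2 (by positivity)
    _ = C * B₃ * B₅ * M ^ 5 * εk * (B₃ * (11 * (d : ℝ) ^ 2 * (1 + β₀) ^ 2 * εk)) * (Rk * (101 ^ d * (M * Rk) ^ d)) *
          (Real.exp (-(δ * M * Rh1)) * Rk ^ β₀ * L ^ ((N - 1) * (d - 2 + d))) := by ring
    _ ≤ C * B₃ * B₅ * M ^ 5 * εk * (B₃ * (11 * (d : ℝ) ^ 2 * (1 + β₀) ^ 2 * εk)) * (Rk * (101 ^ d * (M * Rk) ^ d)) *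
          Real.exp (-Rk) := mul_le_mul_of_nonneg_left hA (by positivity)
    _ = gk ^ 2 * (C * 101 ^ d * 11 * (d : ℝ) ^ 2 * (1 + β₀) ^ 2) * A₀ ^ 2 * B₃ ^ 2 * B₅ * M ^ (d + 5) *
          Rk ^ (d + 1) * p₀g ^ 2 * Real.exp (-Rk) := by
        rw [hε]; ring

end Literature.MathematicalPhysics.QuantumFieldTheory.Balaban1983to89.B16Ineq124Absorption
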